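import Summits.HodgeConjecture.HodgeConjecture.Theorems.AnchorTransportAnchorExistenceK3SquareCMFloorSpan
import Summits.HodgeConjecture.HodgeConjecture.Theorems.AnchorTransportAnchorExistenceK3SquareCMFloorPolarization

/-!
# Route AnchorTransport — `AnchorExistence` (stmt-HodgeConjecture-1077), line `Sketch`, CM floor:
# the CM span theorem in the marking picture

Marking picture (`Λ_ℚ`, `k3FormRat`; period `x ∈ Λ_ℂ`; `N` the rational `(1,1)`-vectors with
`N ∩ N^⊥ = 0`; `T = N^⊥` with its polarized irreducible Hodge structure of K3 type `hodgeT`, files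
`…CMFloorTranscendental`, `…CMFloorPolarization`, `…CMFloorSpan`). **Theorem
(`exists_sum_isometry`).** If some Hodge endomorphism `φ₀` of `Λ_ℚ` acts on `x` by a non-real
scalar (complex multiplication), then every Hodge endomorphism `φ` of `Λ_ℚ` is
`φ = Σᵢ ( · .aᵢ) bᵢ + Σⱼ qⱼ ûⱼ` with `aᵢ, bᵢ ∈ N`, `qⱼ ∈ ℚ` and `ûⱼ` Hodge ISOMETRIES of `Λ_ℚ`.
Proof: `φ|_T ∈ End_Hdg(T)` (`restrict_mem_endAlg`); the embedding `ε : End_Hdg(T) → ℂ` of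
Zarhin's Cor. 3.3.6 (`Zarhin1983_endAlg_isField_holds`) takes the non-real value `μ` on `φ₀|_T`,
so `End_Hdg(T)` is a CM field spanned by Hodge isometries (`span_setOf_isometry_eq_top_of_conj_ne`,
Huybrechts Thm. 3.3.7 / Rem. 3.3.14; Buskin 2019, proof of the Corollary); write
`φ|_T = Σ qⱼ uⱼ`, extend each `uⱼ` by the identity of `N` (`extendT`: Hodge, isometric), and the
remainder `(φ - Σ qⱼ) ∘ pr_N` has image in `N` and kills `T`, hence is a sum of rank-one maps
(`exists_eq_sum_rankOne`).

## References

* [Huybrechts2016K3] D. Huybrechts, Lectures on K3 Surfaces, CUP 2016, Ch. 3 Cor. 3.3.6, Thm. 3.3.7,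
  Rem. 3.3.14.
* [Buskin2019] N. Buskin, J. reine angew. Math. 755 (2019), proof of the Corollary after Thm. 1.1.
* [Huybrechts2019] D. Huybrechts, Comment. Math. Helv. 94 (2019), Cor. 0.4 (ii) and Rem. 3.3.
-/

noncomputable section

set_option linter.dupNamespace false

open scoped TensorProduct
open Module
open Literature.AlgebraicGeometry.Surfaces Literature.AlgebraicGeometry.Motives
open Literature.AlgebraicGeometry.Motives.HodgeStructure
open Summit.HodgeConjecture.HodgeConjecture.Theorems.NikulinTwinTransport

namespace Summit.HodgeConjecture.HodgeConjecture.Theorems.AnchorExistenceCMFloor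

variable {x : K3Index → ℂ} {N : Submodule ℚ (K3Index → ℚ)}

/-- **The CM span theorem in the marking picture** (module docstring): under complex
multiplication every Hodge endomorphism `φ` of `Λ_ℚ` is a sum of rank-one maps `v ↦ (v.aᵢ) bᵢ`
(`aᵢ, bᵢ ∈ N`) and a rational combination of Hodge isometries of `Λ_ℚ`.
[cite: Huybrechts2016K3, Thm. 3.3.7 and Rem. 3.3.14] [cite: Buskin2019, proof of the Corollary after Thm. 1.1]
[cite: Huybrechts2019, Cor. 0.4 (ii) and Rem. 3.3] -/
theorem exists_sum_isometry (hN : ∀ v : K3Index → ℚ, v ∈ N ↔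
      k3Form (fun i => (v i : ℂ)) x = 0 ∧ k3Form (fun i => (v i : ℂ)) (star x) = 0)
    (hdisj : Disjoint N (k3FormRat.orthogonal N)) (hxx : k3Form x x = 0) (hxpos : 0 < (k3Form (star x) x).re)
    (hu : ∃ u : K3Index → ℤ, k3Form (fun i => (u i : ℂ)) x = 0 ∧ 0 < ∑ i, ∑ j, u i * k3Gram i j * u j)
    (φ₀ : Module.End ℚ (K3Index → ℚ)) (μ : ℂ) (hμ : μ.im ≠ 0) (hφ₀x : cxEnd φ₀ x = μ • x)
    (hφ₀11 : ∀ z : K3Index → ℂ, k3Form z x = 0 → k3Form z (star x) = 0 →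
      k3Form (cxEnd φ₀ z) x = 0 ∧ k3Form (cxEnd φ₀ z) (star x) = 0)
    (φ : Module.End ℚ (K3Index → ℚ)) (hφx : ∃ c : ℂ, cxEnd φ x = c • x)
    (hφ11 : ∀ z : K3Index → ℂ, k3Form z x = 0 → k3Form z (star x) = 0 →
      k3Form (cxEnd φ z) x = 0 ∧ k3Form (cxEnd φ z) (star x) = 0) :
    ∃ (m : ℕ) (a b : Fin m → K3Index → ℚ) (k : ℕ) (q : Fin k → ℚ) (υ : Fin k → Module.End ℚ (K3Index → ℚ)),
      (∀ i, a i ∈ N) ∧ (∀ i, b i ∈ N) ∧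
      (∀ j, (∀ v w, k3FormRat (υ j v) (υ j w) = k3FormRat v w) ∧ (∃ c : ℂ, cxEnd (υ j) x = c • x) ∧
        ∀ z : K3Index → ℂ, k3Form z x = 0 → k3Form z (star x) = 0 →
          k3Form (cxEnd (υ j) z) x = 0 ∧ k3Form (cxEnd (υ j) z) (star x) = 0) ∧
      ∀ v, φ v = (∑ i, k3FormRat v (a i) • b i) + ∑ j, q j • υ j v := by
  classical
  have hc := isCompl_orthogonal hdisj
  set H := hodgeT hN hdisj hxx hxpos with hH
  have hK3 : H.IsOfK3Type := isOfK3Type_hodgeT hN hdisj hxx hxpos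
  have hirr : H.IsIrreducible := isIrreducible_hodgeT hN hdisj hxx hxpos
  set ψ : H.Polarization := polT hN hdisj hxx hxpos hu with hψ
  -- `N`- and `T`-stability
  have hφ₀T : ∀ t ∈ k3FormRat.orthogonal N, φ₀ t ∈ k3FormRat.orthogonal N :=
    fun t ht => map_mem_T hN φ₀ ⟨μ, hφ₀x⟩ ht
  have hφT : ∀ t ∈ k3FormRat.orthogonal N, φ t ∈ k3FormRat.orthogonal N := fun t ht => map_mem_T hN φ hφx ht
  have hφN : ∀ n ∈ N, φ n ∈ N := fun n hn => map_mem_N hN φ hφ11 hn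
  -- the CM element of `End_Hdg(T)` and the embedding `ε`
  set a₀ : H.endAlg := ⟨φ₀.restrict hφ₀T, restrict_mem_endAlg hN hdisj hxx hxpos φ₀ hφ₀T ⟨μ, hφ₀x⟩ hφ₀11⟩ with ha₀
  obtain ⟨-, ε, -, hε⟩ := Zarhin1983_endAlg_isField_holds H hirr hK3
  have ha₀ω : (φ₀.restrict hφ₀T).baseChange ℂ (omega x hdisj) = μ • omega x hdisj := by
    apply iota_injective
    rw [iota_baseChange_restrict, iota_omega hN hdisj, map_smul, iota_omega hN hdisj, hφ₀x]
  have hεa₀ : ε a₀ = μ := by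
    have h := hε a₀ (omega x hdisj) ((mem_piece_two_zero_ofPeriod _ _).2 ⟨1, one_smul _ _⟩)
    change (φ₀.restrict hφ₀T).baseChange ℂ (omega x hdisj) = _ at h
    rw [ha₀ω] at h
    exact (smul_left_injective ℂ (omega_ne_zero hN hdisj hxpos) h).symm
  have hCM : ∃ (φ' : H.endAlg →+* ℂ) (a : H.endAlg), starRingEnd ℂ (φ' a) ≠ φ' a := by
    refine ⟨ε.toRingHom, a₀, ?_⟩
    change starRingEnd ℂ (ε a₀) ≠ ε a₀
    rw [hεa₀]
    exact fun h => hμ (Complex.conj_eq_iff_im.1 h)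
  have hspan := span_setOf_isometry_eq_top_of_conj_ne hirr hK3 ψ hCM
  -- `φ|_T` in the span of the Hodge isometries
  set fT : H.endAlg := ⟨φ.restrict hφT, restrict_mem_endAlg hN hdisj hxx hxpos φ hφT hφx hφ11⟩ with hfT
  have hmem : fT ∈ Submodule.span ℚ {u : H.endAlg | ∀ v w : k3FormRat.orthogonal N,
      ψ.form ((u : Module.End ℚ (k3FormRat.orthogonal N)) v) ((u : Module.End ℚ (k3FormRat.orthogonal N)) w) =
        ψ.form v w} := by
    rw [hspan]; exact Submodule.mem_top
  obtain ⟨k, q, g, hsum⟩ := Submodule.mem_span_set'.1 hmem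
  have hsumT : ∑ j, q j • ((g j : H.endAlg) : Module.End ℚ (k3FormRat.orthogonal N)) = φ.restrict hφT := by
    have h := congrArg H.endAlg.val hsum
    rw [map_sum] at h
    simpa only [map_smul, Subalgebra.coe_val] using h
  -- the isometries `uⱼ` and their extensions `ûⱼ`
  have hgiso : ∀ j (v w : k3FormRat.orthogonal N),
      k3FormRat (((g j : H.endAlg) : Module.End ℚ (k3FormRat.orthogonal N)) v)
        (((g j : H.endAlg) : Module.End ℚ (k3FormRat.orthogonal N)) w) = k3FormRat v w := by
    intro j v w
    have h := (g j).2 v w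
    change (-(k3FormRat.restrict (k3FormRat.orthogonal N))) _ _ = (-(k3FormRat.restrict (k3FormRat.orthogonal N))) v w at h
    rw [LinearMap.neg_apply, LinearMap.neg_apply, LinearMap.neg_apply, LinearMap.neg_apply, neg_inj,
      LinearMap.BilinForm.restrict_apply, LinearMap.BilinForm.restrict_apply, LinearMap.domRestrict_apply,
      LinearMap.domRestrict_apply] at h
    exact h
  set υ : Fin k → Module.End ℚ (K3Index → ℚ) :=
    fun j => extendT hdisj ((g j : H.endAlg) : Module.End ℚ (k3FormRat.orthogonal N)) with hυ
  -- the remainder `(φ - s) ∘ pr_N`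
  set s : ℚ := ∑ j, q j with hs
  set P := N.projection _ hc with hP
  set G : Module.End ℚ (K3Index → ℚ) := (φ - s • LinearMap.id) ∘ₗ P with hG
  have hGN : ∀ v, G v ∈ N := fun v => by
    rw [hG, LinearMap.comp_apply, LinearMap.sub_apply, LinearMap.smul_apply, LinearMap.id_apply]
    exact N.sub_mem (hφN _ (Submodule.projection_apply_mem hc v)) (N.smul_mem _ (Submodule.projection_apply_mem hc v))
  have hGT : ∀ t ∈ k3FormRat.orthogonal N, G t = 0 := fun t ht => by
    rw [hG, LinearMap.comp_apply, hP, Submodule.projection_apply_of_mem_right hc ht, map_zero]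
  obtain ⟨m, a, b, ha, hb, hGsum⟩ := exists_eq_sum_rankOne k3FormRat_isSymm k3FormRat_nondegenerate N G hGN hGT
  refine ⟨m, a, b, k, q, υ, ha, hb, fun j => ⟨k3FormRat_extendT hdisj _ (hgiso j),
    cxEnd_extendT_period hN hdisj hxx hxpos (g j).1.2, fun z hzx hzx' =>
      k3Form_cxEnd_extendT hN hdisj hxx hxpos (g j).1.2 hzx hzx'⟩, fun v => ?_⟩
  -- the identity `φ v = G v + Σ qⱼ ûⱼ v`
  set Q' := (k3FormRat.orthogonal N).projectionOnto N hc.symm with hQ'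
  have hv : v = P v + (Q' v : K3Index → ℚ) := by
    rw [hQ', Submodule.coe_projectionOnto_apply, hP]
    exact (Submodule.projection_add_projection_eq_self hc v).symm
  have hυv : ∀ j, υ j v = ((((g j : H.endAlg) : Module.End ℚ (k3FormRat.orthogonal N)) (Q' v) :
      k3FormRat.orthogonal N) : K3Index → ℚ) + P v := fun j => rfl
  have hφQ : φ (Q' v : K3Index → ℚ) =
      ∑ j, q j • ((((g j : H.endAlg) : Module.End ℚ (k3FormRat.orthogonal N)) (Q' v) :
        k3FormRat.orthogonal N) : K3Index → ℚ) := by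
    have h := congrArg (fun t : k3FormRat.orthogonal N => (t : K3Index → ℚ)) (LinearMap.congr_fun hsumT (Q' v))
    simp only [LinearMap.coe_restrict_apply, LinearMap.sum_apply, LinearMap.smul_apply, Submodule.coe_sum,
      Submodule.coe_smul] at h
    exact h.symm
  rw [← hGsum v]
  simp only [hυv, smul_add, Finset.sum_add_distrib]
  rw [← hφQ, ← Finset.sum_smul, ← hs, hG, LinearMap.comp_apply, LinearMap.sub_apply, LinearMap.smul_apply,
    LinearMap.id_apply]
  conv_lhs => rw [hv, map_add]
  abel

end Summit.HodgeConjecture.HodgeConjecture.Theorems.AnchorExistenceCMFloor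

end
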